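import Summits.ValiantsHypothesis.ValiantsHypothesis.Theorems.SymPencilSingFiveBricks
import Summits.ValiantsHypothesis.ValiantsHypothesis.Theorems.SymPencilSingFiveLeafCross
import Summits.ValiantsHypothesis.ValiantsHypothesis.Theorems.SymPencilSingFiveLeafWcol
import Summits.ValiantsHypothesis.ValiantsHypothesis.Theorems.SymPencilSingFiveLeafRowCol
import Summits.ValiantsHypothesis.ValiantsHypothesis.Theorems.SymPencilSingFiveLeafRows
import Summits.ValiantsHypothesis.ValiantsHypothesis.Theorems.SymPencilPerFourTwoRowsCommonZeroColumn
import Summits.ValiantsHypothesis.ValiantsHypothesis.Theorems.SymPencilSdcPerFourCellElevenFive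

/-!
# Route `SymPencil` — the V-side of the size-27 cell `(11, 5, 4)`: `noJointFamily_five_four` and the cell, UNCONDITIONALLY
# (`--supports` stmt-ValiantsHypothesis-5674 `SdcSuperquadratic`; port of §4–5 of
# `Cruxes/SdcSuperquadratic/Lines/sing_five_classification.lean` rev 10/11 (val-idea-18 g5, memo
# `SING-FIVE-CLASSIFICATION.md`) over the ported leaves; PORT-PLAN-115.md; rung currency only)

The kernel-checked dispatch of the `(11, 5, 4)` cascade on top of ✓ `zeroLine` (T5): transposition glue, `twoZeroRows_noJoint_of`,
`rowBranch_of`, `noJointFamily_five_four_of`; the leaves by name — `leafX` (✓ `crossFive`), `leafR2` (✓ p640412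
`twoZeroRows_common_zero_column`), `leafE` (✓ `wcolFive`), `leafR1C` (✓ `threeByThree`), leaf R1N ✓ `threeRowsFourCols` (whose
residual `R1NToric ∧ R1NProduct` is ✓ `r1nToric` / ✓ `r1nProduct`), ✓ `torusDispatch`; hence
**`noJointFamily_five_four`**: no `5`-dimensional `W ⊆ Sing₃` carries a JOINT family of four squares (LIST₅ / `H115₄ʲ`); and
**`false_of_rank_eleven_le_twentySeven`**: the cell `(11, 5, 4)` of the size-`27` table is EMPTY, unconditionally
(✓ `SymPencilSdcPerFourCellElevenFive.false_of_rank_eleven_le_twentySeven_of_noJointFour` with `hV` discharged).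

Honest framing: [folklore]; size-27 table after this file: DEAD (10,6,6), (13,3,0), (9,7,8), (12,4,2), (11,5,4); OPEN (8,8,10) mod
IR10 — so the window `27 ≤ sdc(per₄) ≤ 29` is UNCHANGED; the crux `SdcSuperquadratic` stays OPEN; `VP ≠ VNP`
is not moved; no summit statement is proved here.  No definitions, no named facts.
-/

noncomputable section

-- single-conjunct layout: Sub = Summit, duplicated namespace component intended
set_option linter.dupNamespace false

namespace Summit.ValiantsHypothesis.ValiantsHypothesis.Theorems.SymPencilSingFiveClassification

open MvPolynomial Module Matrix
open scoped Polynomial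
open Literature.Computability.AlgebraicComplexity
open Summit.ValiantsHypothesis.ValiantsHypothesis.Theorems
open Summit.ValiantsHypothesis.ValiantsHypothesis.Theorems.SymPencilSingSixClassification
open Summit.ValiantsHypothesis.ValiantsHypothesis.Theorems.SymPencilPerFourJointFamilyTransport

variable {K : Type*} [Field K]

/-! ## 4. Transposition glue -/

/-- Membership in the transposed space. [folklore] -/
theorem mem_map_transposeL {W : Submodule K (Fin 4 × Fin 4 → K)} {y : Fin 4 × Fin 4 → K} :
    y ∈ W.map (transposeL (K := K) : (Fin 4 × Fin 4 → K) →ₗ[K] (Fin 4 × Fin 4 → K)) ↔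
      (fun p : Fin 4 × Fin 4 => y (p.2, p.1)) ∈ W := by
  rw [Submodule.mem_map_equiv]
  exact Iff.rfl

/-- A joint family transports to the transposed space (`jointFamily_map` with `χ = 1`). [folklore] -/
theorem hasJointFour_map_transposeL {W : Submodule K (Fin 4 × Fin 4 → K)} (h : HasJointFour W) :
    HasJointFour (W.map (transposeL (K := K) : (Fin 4 × Fin 4 → K) →ₗ[K] (Fin 4 × Fin 4 → K))) := by
  obtain ⟨c, β, hJ⟩ := h
  obtain ⟨c', β', h'⟩ := jointFamily_map W (transposeL (K := K)) 1
    (fun z => by rw [one_mul]; exact SymPencilPerFourTwoRowsRadical.eval_perPoly_transpose z) c β hJ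
  exact ⟨c', β', h'⟩

/-- Finrank is preserved by transposition. [folklore] -/
theorem finrank_map_transposeL (W : Submodule K (Fin 4 × Fin 4 → K)) :
    finrank K (W.map (transposeL (K := K) : (Fin 4 × Fin 4 → K) →ₗ[K] (Fin 4 × Fin 4 → K))) =
      finrank K W :=
  LinearEquiv.finrank_map_eq _ _

/-- A zero column becomes a zero row after transposition. [folklore] -/
theorem zeroRow_map_transposeL {W : Submodule K (Fin 4 × Fin 4 → K)} {j : Fin 4}
    (h : ∀ x ∈ W, ∀ i : Fin 4, x (i, j) = 0) :
    ∀ x ∈ W.map (transposeL (K := K) : (Fin 4 × Fin 4 → K) →ₗ[K] (Fin 4 × Fin 4 → K)),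
      ∀ i : Fin 4, x (j, i) = 0 := by
  intro x hx i
  exact h _ (mem_map_transposeL.mp hx) i

/-- Two zero columns become two zero rows after transposition. [folklore] -/
theorem twoZeroRows_map_transposeL {W : Submodule K (Fin 4 × Fin 4 → K)} (h : TwoZeroCols W) :
    TwoZeroRows (W.map (transposeL (K := K) : (Fin 4 × Fin 4 → K) →ₗ[K] (Fin 4 × Fin 4 → K))) := by
  obtain ⟨p, q, hpq, hW⟩ := h
  refine ⟨p, q, hpq, fun x hx j => ?_⟩
  exact hW _ (mem_map_transposeL.mp hx) j

/-! ## The leaves, by name (ports of the workfile's `stub_crossFive`, `stub_twoZeroRows`, `stub_wcolFive`, `stub_threeByThree`) -/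

/-- **Leaf X** (the workfile's `stub_crossFive`): a `5`-dimensional `W` in a cross with `PerDirFour` is of `V₅×`-type
(✓ `crossFive`). [folklore] -/
theorem leafX [CharZero K] :
    ∀ W : Submodule K (Fin 4 × Fin 4 → K), finrank K W = 5 → InCross W → PerDirFour W →
      VFiveCrossType W := by
  intro W h5 hX hW
  obtain ⟨l, c, hX⟩ := hX
  obtain ⟨a, b, hac, hbl, hmem⟩ := crossFive W hX h5 hW
  exact ⟨l, c, a, b, hac, hbl, hmem⟩

/-- **Leaf R2** (the workfile's `stub_twoZeroRows`; ✓ `SymPencilPerFourTwoRowsCommonZeroColumn.twoZeroRows_common_zero_column`,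
p640412): two zero rows and `PerDirFour` force a common zero column of the two live rows. [folklore] -/
theorem leafR2 [CharZero K] :
    ∀ W : Submodule K (Fin 4 × Fin 4 → K), finrank K W = 5 → TwoZeroRows W → PerDirFour W →
      ∃ p q m : Fin 4, p ≠ q ∧ InWCol W p q m :=
  fun W h5 h2 hP => SymPencilPerFourTwoRowsCommonZeroColumn.twoZeroRows_common_zero_column W h5 h2 hP

/-- **Leaf E** (the workfile's `stub_wcolFive`; ✓ `wcolFive`): `W ⊆ W_col(p,q;m)` of dimension `5` with a per-point family of four
squares is of torus type. [folklore] -/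
theorem leafE [CharZero K] :
    ∀ W : Submodule K (Fin 4 × Fin 4 → K), finrank K W = 5 → ∀ p q m : Fin 4, p ≠ q →
      InWCol W p q m → PerPointFour W → VTorusType W := by
  intro W h5 p q m hpq hcol hP
  exact wcolFive W h5 p q m hpq hcol hP

/-- **Leaf R1C** (the workfile's `stub_threeByThree`; ✓ `threeByThree`, point lemma ✓ `SymPencilPerFourBlockPointLemma.blockPoint33`).
[folklore] -/
theorem leafR1C [CharZero K] :
    ∀ W : Submodule K (Fin 4 × Fin 4 → K), Sing3 W → finrank K W = 5 →
      (∃ i : Fin 4, ∀ x ∈ W, ∀ j : Fin 4, x (i, j) = 0) →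
      (∃ j : Fin 4, ∀ x ∈ W, ∀ i : Fin 4, x (i, j) = 0) →
      ¬ TwoZeroRows W → ¬ TwoZeroCols W → ¬ InCross W → PerDirFour W → False := by
  intro W hS h5 hi hj h2r h2c hX hP
  exact threeByThree W hS h5 hi hj h2r h2c hX (fun y hy => hP y hy)

/-! ## 5. The kernel-checked dispatch -/

/-- **Two zero rows ⇒ no joint family** (R2 ∘ E ∘ torus bricks). [folklore] -/
theorem twoZeroRows_noJoint_of [CharZero K]
    (hR2 : ∀ W : Submodule K (Fin 4 × Fin 4 → K), finrank K W = 5 → TwoZeroRows W → PerDirFour W →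
      ∃ p q m : Fin 4, p ≠ q ∧ InWCol W p q m)
    (hE : ∀ W : Submodule K (Fin 4 × Fin 4 → K), finrank K W = 5 → ∀ p q m : Fin 4, p ≠ q →
      InWCol W p q m → PerPointFour W → VTorusType W)
    (hT : ∀ W : Submodule K (Fin 4 × Fin 4 → K), VTorusType W → ¬ HasJointFour W)
    (W : Submodule K (Fin 4 × Fin 4 → K)) (h5 : finrank K W = 5) (h2 : TwoZeroRows W) :
    ¬ HasJointFour W := by
  rintro ⟨c, β, hJ⟩
  obtain ⟨p, q, m, hpq, hWc⟩ := hR2 W h5 h2 (perDirFour_of_jointFour hJ)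
  exact hT W (hE W h5 p q m hpq hWc (perPointFour_of_jointFour hJ)) ⟨c, β, hJ⟩

/-- **ROW BRANCH**: a `5`-dimensional singular `W` with a zero row carries no joint family of four
squares — from the five leaves and the torus dispatch. [folklore] -/
theorem rowBranch_of [CharZero K]
    (hX : ∀ W : Submodule K (Fin 4 × Fin 4 → K), finrank K W = 5 → InCross W → PerDirFour W →
      VFiveCrossType W)
    (hR2 : ∀ W : Submodule K (Fin 4 × Fin 4 → K), finrank K W = 5 → TwoZeroRows W → PerDirFour W →
      ∃ p q m : Fin 4, p ≠ q ∧ InWCol W p q m)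
    (hE : ∀ W : Submodule K (Fin 4 × Fin 4 → K), finrank K W = 5 → ∀ p q m : Fin 4, p ≠ q →
      InWCol W p q m → PerPointFour W → VTorusType W)
    (h33 : ∀ W : Submodule K (Fin 4 × Fin 4 → K), Sing3 W → finrank K W = 5 →
      (∃ i : Fin 4, ∀ x ∈ W, ∀ j : Fin 4, x (i, j) = 0) →
      (∃ j : Fin 4, ∀ x ∈ W, ∀ i : Fin 4, x (i, j) = 0) →
      ¬ TwoZeroRows W → ¬ TwoZeroCols W → ¬ InCross W → PerDirFour W → False)
    (h34 : ∀ W : Submodule K (Fin 4 × Fin 4 → K), Sing3 W → finrank K W = 5 →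
      (∃ i : Fin 4, ∀ x ∈ W, ∀ j : Fin 4, x (i, j) = 0) →
      ¬ (∃ j : Fin 4, ∀ x ∈ W, ∀ i : Fin 4, x (i, j) = 0) →
      ¬ TwoZeroRows W → ¬ InCross W → PerDirFour W → False)
    (hT : ∀ W : Submodule K (Fin 4 × Fin 4 → K), VTorusType W → ¬ HasJointFour W) :
    ∀ W : Submodule K (Fin 4 × Fin 4 → K), Sing3 W → finrank K W = 5 →
      (∃ i : Fin 4, ∀ x ∈ W, ∀ j : Fin 4, x (i, j) = 0) → ¬ HasJointFour W := by
  intro W hS h5 hrow hHas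
  obtain ⟨c, β, hJ⟩ := hHas
  have hPD := perDirFour_of_jointFour hJ
  by_cases hXc : InCross W
  · exact noJoint_of_vFiveCrossType (hX W h5 hXc hPD) ⟨c, β, hJ⟩
  by_cases h2 : TwoZeroRows W
  · exact twoZeroRows_noJoint_of hR2 hE hT W h5 h2 ⟨c, β, hJ⟩
  by_cases h2c : TwoZeroCols W
  · -- transpose: two zero columns become two zero rows
    set W' := W.map (transposeL (K := K) : (Fin 4 × Fin 4 → K) →ₗ[K] (Fin 4 × Fin 4 → K)) with hW'
    have h5' : finrank K W' = 5 := by rw [hW', finrank_map_transposeL]; exact h5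
    exact twoZeroRows_noJoint_of hR2 hE hT W' h5' (twoZeroRows_map_transposeL h2c)
      (hasJointFour_map_transposeL ⟨c, β, hJ⟩)
  by_cases hzc : ∃ j : Fin 4, ∀ x ∈ W, ∀ i : Fin 4, x (i, j) = 0
  · exact h33 W hS h5 hrow hzc h2 h2c hXc hPD
  · exact h34 W hS h5 hrow hzc h2 hXc hPD

/-- **THE DISPATCH (kernel-checked): the five leaves + the torus plumbing ⇒ no `5`-dimensional
`W ⊆ Sing Z(per₄)` carries a joint family of four squares.**  Top split = `zeroLine` (T5) BY NAME;
a zero column is transposed into a zero row. [folklore] -/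
theorem noJointFamily_five_four_of [CharZero K]
    (hX : ∀ W : Submodule K (Fin 4 × Fin 4 → K), finrank K W = 5 → InCross W → PerDirFour W →
      VFiveCrossType W)
    (hR2 : ∀ W : Submodule K (Fin 4 × Fin 4 → K), finrank K W = 5 → TwoZeroRows W → PerDirFour W →
      ∃ p q m : Fin 4, p ≠ q ∧ InWCol W p q m)
    (hE : ∀ W : Submodule K (Fin 4 × Fin 4 → K), finrank K W = 5 → ∀ p q m : Fin 4, p ≠ q →
      InWCol W p q m → PerPointFour W → VTorusType W)
    (h33 : ∀ W : Submodule K (Fin 4 × Fin 4 → K), Sing3 W → finrank K W = 5 →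
      (∃ i : Fin 4, ∀ x ∈ W, ∀ j : Fin 4, x (i, j) = 0) →
      (∃ j : Fin 4, ∀ x ∈ W, ∀ i : Fin 4, x (i, j) = 0) →
      ¬ TwoZeroRows W → ¬ TwoZeroCols W → ¬ InCross W → PerDirFour W → False)
    (h34 : ∀ W : Submodule K (Fin 4 × Fin 4 → K), Sing3 W → finrank K W = 5 →
      (∃ i : Fin 4, ∀ x ∈ W, ∀ j : Fin 4, x (i, j) = 0) →
      ¬ (∃ j : Fin 4, ∀ x ∈ W, ∀ i : Fin 4, x (i, j) = 0) →
      ¬ TwoZeroRows W → ¬ InCross W → PerDirFour W → False)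
    (hT : ∀ W : Submodule K (Fin 4 × Fin 4 → K), VTorusType W → ¬ HasJointFour W) :
    ∀ W : Submodule K (Fin 4 × Fin 4 → K), Sing3 W → finrank K W = 5 →
      ∀ (c : Fin 4 → K) (β : Fin 4 → ((Fin 4 × Fin 4 → K) →ₗ[K] (Fin 4 × Fin 4 → K) →ₗ[K] K)),
        ¬ (∀ u : Fin 4 × Fin 4 → K, ∀ y ∈ W, ∃ e₀ e₁ : K, ∀ s : K,
          eval (u + s • y) (perPoly (Fin 4) K) = e₀ + s * e₁ + s ^ 2 * ∑ k, c k * (β k u y) ^ 2) := by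
  intro W hS h5 c β hJ
  have hHas : HasJointFour W := ⟨c, β, hJ⟩
  rcases zeroLine W hS (by rw [h5]) with hXc | ⟨i, hi⟩ | ⟨j, hj⟩
  · exact noJoint_of_vFiveCrossType (hX W h5 hXc (perDirFour_of_jointFour hJ)) hHas
  · exact rowBranch_of hX hR2 hE h33 h34 hT W hS h5 ⟨i, hi⟩ hHas
  · -- zero column: transpose
    set W' := W.map (transposeL (K := K) : (Fin 4 × Fin 4 → K) →ₗ[K] (Fin 4 × Fin 4 → K)) with hW'
    have h5' : finrank K W' = 5 := by rw [hW', finrank_map_transposeL]; exact h5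
    exact rowBranch_of hX hR2 hE h33 h34 hT W' (sing3_map_transposeL hS) h5'
      ⟨j, zeroRow_map_transposeL hj⟩ (hasJointFour_map_transposeL hHas)

/-- **THE OPEN RESIDUAL SUFFICES (kernel-checked, rev 9)**: with leaves X, R2, E, R1C, the torus
plumbing and the R1N normalisation + full-row-rank branch PROVED in this file, the cell's V-side
statement follows from exactly ONE open statement — the NARROWED leaf R1N — taken here as a
hypothesis (its signature literally that of `stub_threeRowsFourCols_residual`). [folklore] -/
theorem noJointFamily_five_four_of_open [CharZero K]
    (hR1N : ∀ W : Submodule K (Fin 4 × Fin 4 → K), Sing3 W → finrank K W = 5 →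
      (∀ x ∈ W, ∀ j : Fin 4, x (3, j) = 0) →
      ¬ (∃ j : Fin 4, ∀ x ∈ W, ∀ i : Fin 4, x (i, j) = 0) →
      ¬ TwoZeroRows W → ¬ InCross W → PerDirFour W →
      (∀ r : Fin 4, W.map (rowL (K := K) r) ≠ ⊤) → False) :
    ∀ W : Submodule K (Fin 4 × Fin 4 → K), Sing3 W → finrank K W = 5 →
      ∀ (c : Fin 4 → K) (β : Fin 4 → ((Fin 4 × Fin 4 → K) →ₗ[K] (Fin 4 × Fin 4 → K) →ₗ[K] K)),
        ¬ (∀ u : Fin 4 × Fin 4 → K, ∀ y ∈ W, ∃ e₀ e₁ : K, ∀ s : K,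
          eval (u + s • y) (perPoly (Fin 4) K) = e₀ + s * e₁ + s ^ 2 * ∑ k, c k * (β k u y) ^ 2) :=
  noJointFamily_five_four_of leafX leafR2 leafE leafR1C
    (threeRowsFourCols_of_residual hR1N) torusDispatch

/-- **THE TWO OPEN BRANCHES SUFFICE (kernel-checked, rev 10)**: the cell's V-side statement from
exactly the two remaining paper branches of leaf R1N — TORIC (memo §6.6) and PRODUCT (memo §6.5) —
taken as hypotheses; everything else (leaves X, R2, E, R1C, torus plumbing, R1N normalisation,
`n_r = 4`, and the kernel-plane dispatch with its GRAPH and PURE branches) is PROVED in this file.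
[folklore] -/
theorem noJointFamily_five_four_of_open₂ [CharZero K] (hT : R1NToric K) (hPr : R1NProduct K) :
    ∀ W : Submodule K (Fin 4 × Fin 4 → K), Sing3 W → finrank K W = 5 →
      ∀ (c : Fin 4 → K) (β : Fin 4 → ((Fin 4 × Fin 4 → K) →ₗ[K] (Fin 4 × Fin 4 → K) →ₗ[K] K)),
        ¬ (∀ u : Fin 4 × Fin 4 → K, ∀ y ∈ W, ∃ e₀ e₁ : K, ∀ s : K,
          eval (u + s • y) (perPoly (Fin 4) K) = e₀ + s * e₁ + s ^ 2 * ∑ k, c k * (β k u y) ^ 2) :=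
  noJointFamily_five_four_of_open (residual_of_toric_product hT hPr)

/-- **`noJointFamily_five_four`** — the V-side statement of cell `(11,5,4)` (LIST₅ ∘ bricks), from
the stubs of this file.  The ONLY sorry (rev 10) is `stub_R1N_residual : R1NToric K ∧ R1NProduct K`
(memo §6.6 + §6.5). [folklore] -/
theorem noJointFamily_five_four [CharZero K] :
    ∀ W : Submodule K (Fin 4 × Fin 4 → K), Sing3 W → finrank K W = 5 →
      ∀ (c : Fin 4 → K) (β : Fin 4 → ((Fin 4 × Fin 4 → K) →ₗ[K] (Fin 4 × Fin 4 → K) →ₗ[K] K)),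
        ¬ (∀ u : Fin 4 × Fin 4 → K, ∀ y ∈ W, ∃ e₀ e₁ : K, ∀ s : K,
          eval (u + s • y) (perPoly (Fin 4) K) = e₀ + s * e₁ + s ^ 2 * ∑ k, c k * (β k u y) ^ 2) :=
  noJointFamily_five_four_of leafX leafR2 leafE leafR1C
    threeRowsFourCols torusDispatch

/-! ## The cell `(11, 5, 4)` of the size-`27` table, UNCONDITIONALLY -/

/-- **The cell `(11, 5, 4)` of the size-`27` kernel-package table is EMPTY** (the CELLS-27 §(i) template at `r = 11`,
✓ `SymPencilSdcPerFourCellElevenFive.false_of_rank_eleven_le_twentySeven_of_noJointFour` with its hypothesis `hV` discharged by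
`noJointFamily_five_four`).  Rung currency only: the window `27 ≤ sdc(per₄) ≤ 29` is UNCHANGED by this file alone (the cell
`(8,8,10)` remains conditional on IR10); the crux `SdcSuperquadratic` and `VP ≠ VNP` untouched. [folklore] -/
theorem false_of_rank_eleven_le_twentySeven (K : Type*) [Field K] [CharZero K]
    {m : ℕ} (hm : m ≤ 27)
    {i₀ : Fin m} {D : Matrix {i // i ≠ i₀} {i // i ≠ i₀} K}
    {bL : (Fin 4 × Fin 4 → K) →ₗ[K] ({i // i ≠ i₀} → K)}
    {CL : (Fin 4 × Fin 4 → K) →ₗ[K] Matrix {i // i ≠ i₀} {i // i ≠ i₀} K} {κ : K}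
    (hD : IsUnit D.det) (hDs : Dᵀ = D) (hCs : ∀ z, (CL z)ᵀ = CL z) (hκ : κ ≠ 0)
    (hi : ∀ z, bL z ⬝ᵥ D⁻¹ *ᵥ bL z = 0)
    (hii : ∀ z, bL z ⬝ᵥ (D⁻¹ * CL z * D⁻¹) *ᵥ bL z = 0)
    (hiii : ∀ z, D.det * (bL z ⬝ᵥ (D⁻¹ * CL z * D⁻¹ * CL z * D⁻¹) *ᵥ bL z) =
      -(κ * eval z (perPoly (Fin 4) K)))
    (hV4 : ∀ x ∈ LinearMap.ker bL, ∀ r c : Fin 4,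
      ((Matrix.of fun i j => x (i, j)).submatrix r.succAbove c.succAbove).permanent = 0)
    (hcard : Fintype.card {i // i ≠ i₀} + 1 = m)
    (hranle : 2 * finrank K (LinearMap.range bL) ≤ Fintype.card {i // i ≠ i₀})
    (hrn : finrank K (LinearMap.range bL) + finrank K (LinearMap.ker bL) = 16)
    (hN : ∀ v, bL v = 0 → IsUnit (D + CL v).det ∧ ∀ (z : Fin 4 × Fin 4 → K) (s : K),
      κ * eval (v + s • z) (perPoly (Fin 4) K) =
        (Matrix.fromBlocks ((s * 0) • (1 : Matrix Unit Unit K))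
          (Matrix.replicateRow Unit (s • bL z)) (Matrix.replicateCol Unit (s • bL z))
          (D + CL v + s • CL z)).det)
    (h11 : finrank K (LinearMap.range bL) = 11) : False :=
  SymPencilSdcPerFourCellElevenFive.false_of_rank_eleven_le_twentySeven_of_noJointFour K hm hD hDs hCs hκ hi hii
    hiii hV4 hcard hranle hrn hN (fun W hS h5 c β => noJointFamily_five_four W hS h5 c β) h11

end Summit.ValiantsHypothesis.ValiantsHypothesis.Theorems.SymPencilSingFiveClassification
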